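import Literature.MeasureTheory.RestrictedProduct.Haar

/-!
# Restricted product measures, VII: every left-invariant measure is a restricted product measure

Topic `MeasureTheory/RestrictedProduct`; continues `Haar`. Rescaling ONE local measure inside `S₀` by `c`
rescales the restricted product measure by `c` (`rpMeasure_eq_smul`, pure measure theory); combined with the
Haar uniqueness transfer `eq_smul_rpMeasure` this shows that EVERY σ-finite left-invariant Borel measure `μ'`
on the restricted product group `Πʳ i, [G i, B i]` (setting of `Haar`) is automatically finite on `K₀`
(`measure_haarBox_ne_top`) and IS the restricted product measure of the local Haar measures rescaled at one
place `i₀ ∈ S₀` by `haarScalar μ' = μ'(K₀) / ∏_{i∈S₀} ν_i(C_i) : ℝ≥0` (**`eq_rpMeasure_update`**). So any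
text's own Haar measure `dg` on a restricted product (not only the normalised product measure) satisfies the
product formula of `ProductMeasureRestrict` / Tate's `dα = dα_S` on `G_S` (Cassels–Fröhlich (1967) Ch. XV
§3.3 [CasselsFrohlichANT1967]) on the nose, with the single rescaled local factor absorbing the normalisation.

* `kap_congr`, `rho_congr`, `rpMeasure_eq_smul`, `sigmaFinite_update` — rescaling (no topology);
* `measure_haarBox_ne_top`, `haarScalar`, `eq_rpMeasure_update` — the group statements.

Everything is proved (Mathlib only).

The underlying restricted product MEASURE (`rpMeasure`, files `ProductMeasure`/`ProductMeasureRestrict`) is the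
"restricted product of measure spaces" of Guichardet (1972), App. D §D.3, Definition D.3, p. 166 (PDF p. 95)
[Guichardet1972]: `μ_i(Y_i) = 1`, `μ_(J) = ⊗_{i∈J} μ_i ⊗ ⊗_{i∉J} (μ_i|Y_i)` on `X_(J)`, "there exists a unique measure
`μ` on `X` such that `μ | X_(J) = μ_(J)` for all `J`".

## Provenance

Reproduced for the tree under the LEAN-IN-TREE rule (2026-08-18) from the pub-hodgecm cell's package file
`HodgeCM/PerL34/RestrictedMeasureBorel.lean` (DAG-node prover #09 lineage, seat pv09-g2, gate run 22; 639 lines,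
its datum-free content split in three here: `Borel`, `Haar`, `HaarRescale`), verbatim up to the namespace
(`HodgeCM.PerL34.RestrictedMeasure` ↦ `Literature.MeasureTheory.RestrictedProduct`) and the added docstrings.
-/

set_option autoImplicit false

noncomputable section

open _root_.MeasureTheory Set Filter Function
open _root_.Topology

open scoped RestrictedProduct ENNReal NNReal

namespace Literature.MeasureTheory.RestrictedProduct

universe u v

section rescale

variable {ι : Type u} {G : ι → Type v} [∀ i, MeasurableSpace (G i)] [Countable ι]
  (K : ∀ i, Set (G i)) (hKne : ∀ i, (K i).Nonempty)

omit [Countable ι] in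
/-- `κ_i` depends only on `ν_i`. [folklore] -/
theorem kap_congr {ν ν' : ∀ i, Measure (G i)} {i : ι} (h : ν' i = ν i) :
    kap K ν' hKne i = kap K ν hKne i := by
  unfold kap; rw [h]

omit [Countable ι] in
/-- `ρ_S` depends only on the `ν_i`, `i ∉ S`. [folklore] -/
theorem rho_congr {ν ν' : ∀ i, Measure (G i)} (S : Finset ι) (h : ∀ i, i ∉ S → ν' i = ν i) :
    rho K ν' hKne S = rho K ν hKne S := by
  unfold rho
  congr 1
  funext i
  exact kap_congr K hKne (h i i.2)

include hKne in
/-- Rescaling the local measure at one place `i₀ ∈ S₀` by `c` rescales the restricted product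
measure by `c`. [folklore] -/
theorem rpMeasure_eq_smul (ν ν' : ∀ i, Measure (G i)) [∀ i, SigmaFinite (ν i)]
    [∀ i, SigmaFinite (ν' i)] (hKm : ∀ i, MeasurableSet (K i)) {S₀ : Finset ι}
    (hK1 : ∀ i, i ∉ S₀ → ν i (K i) = 1) {i₀ : ι} (hi₀ : i₀ ∈ S₀) (c : ℝ≥0∞)
    (h0 : ν' i₀ = c • ν i₀) (hne : ∀ i, i ≠ i₀ → ν' i = ν i) :
    rpMeasure K ν' S₀ = c • rpMeasure K ν S₀ := by
  classical
  have hK1' : ∀ i, i ∉ S₀ → ν' i (K i) = 1 := fun i hi => by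
    rw [hne i (fun h => hi (h ▸ hi₀))]; exact hK1 i hi
  symm
  refine eq_rpMeasure K ν' hKne hKm hK1' _ fun S hS => ?_
  haveI := isProbabilityMeasure_rho K ν hKne hKm S
  rw [Measure.restrict_smul, rpMeasure_restrict_rpBox K ν hKne hKm hK1 hS, ← Measure.map_smul,
    ← Measure.prod_smul_left, rho_congr K hKne S (fun i hi => hne i (fun h => hi (h ▸ hS hi₀)))]
  congr 2
  symm
  refine Measure.pi_eq fun s _ => ?_
  have hj₀ : (⟨i₀, hS hi₀⟩ : {i // i ∈ S}) ∈ (Finset.univ : Finset {i // i ∈ S}) :=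
    Finset.mem_univ _
  rw [Measure.smul_apply, smul_eq_mul, Measure.pi_pi,
    ← Finset.mul_prod_erase Finset.univ (fun j : {i // i ∈ S} => ν j (s j)) hj₀,
    ← Finset.mul_prod_erase Finset.univ (fun j : {i // i ∈ S} => ν' j (s j)) hj₀, ← mul_assoc]
  congr 1
  · show c * ν i₀ (s ⟨i₀, hS hi₀⟩) = ν' i₀ (s ⟨i₀, hS hi₀⟩)
    rw [h0, Measure.smul_apply, smul_eq_mul]
  · refine Finset.prod_congr rfl fun j hj => ?_
    rw [hne j (fun h => (Finset.ne_of_mem_erase hj) (Subtype.ext h))]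

omit [Countable ι] in
/-- σ-finiteness survives rescaling one local measure by a finite constant. [folklore] -/
theorem sigmaFinite_update [DecidableEq ι] (ν : ∀ i, Measure (G i)) [∀ i, SigmaFinite (ν i)]
    (i₀ : ι) (c : ℝ≥0) (i : ι) : SigmaFinite (Function.update ν i₀ (c • ν i₀) i) := by
  by_cases h : i = i₀
  · subst h; rw [Function.update_self]; infer_instance
  · rw [Function.update_of_ne h]; infer_instance

end rescale

section anyHaar

variable {ι : Type u} {G : ι → Type v} [∀ i, Group (G i)] [∀ i, TopologicalSpace (G i)]
  [∀ i, IsTopologicalGroup (G i)] [∀ i, T2Space (G i)] [∀ i, SecondCountableTopology (G i)]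
  [∀ i, MeasurableSpace (G i)] [∀ i, BorelSpace (G i)] [Countable ι] [DecidableEq ι]
  (B : ∀ i, Subgroup (G i)) [hBo : Fact (∀ i, IsOpen (B i : Set (G i)))]
  (S₀ : Finset ι) (C : ∀ i, TopologicalSpace.PositiveCompacts (G i))
  (ν : ∀ i, Measure (G i)) [∀ i, SigmaFinite (ν i)] [∀ i, (ν i).IsHaarMeasure]

omit [∀ i, T2Space (G i)] [DecidableEq ι] [∀ i, SigmaFinite (ν i)] [∀ i, (ν i).IsHaarMeasure] in
/-- A σ-finite left-invariant Borel measure on the restricted product group is FINITE on `K₀`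
(automatic: Haar uniqueness `μ' = μ' K₀ • haarMeasure K₀` and σ-finiteness exclude `μ' K₀ = ∞`). [folklore] -/
theorem measure_haarBox_ne_top (hBc : ∀ i, i ∉ S₀ → IsCompact (B i : Set (G i)))
    (μ' : Measure (Πʳ i, [G i, B i])) [SigmaFinite μ'] [μ'.IsMulLeftInvariant] :
    μ' (haarBox B S₀ C) ≠ ∞ := by
  have hBm : ∀ i, MeasurableSet (B i : Set (G i)) := fun i => (hBo.out i).measurableSet
  haveI : BorelSpace (Πʳ i, [G i, B i]) := borelSpace (fun i => (B i : Set (G i))) hBm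
  haveI : SecondCountableTopology (Πʳ i, [G i, B i]) :=
    secondCountableTopology (fun i => (B i : Set (G i))) hBo.out
  intro h
  have h1 := Measure.haarMeasure_unique μ' (haarCompacts B S₀ C hBc)
  have hK : ((haarCompacts B S₀ C hBc : Set (Πʳ i, [G i, B i]))) = haarBox B S₀ C := rfl
  rw [hK, h] at h1
  have hS : ∀ n, Measure.haarMeasure (haarCompacts B S₀ C hBc) (spanningSets μ' n) = 0 := fun n => by
    by_contra hne
    have hlt := measure_spanningSets_lt_top μ' n
    have e := congrArg (fun m : Measure (Πʳ i, [G i, B i]) => m (spanningSets μ' n)) h1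
    simp only [Measure.smul_apply, smul_eq_mul, ENNReal.top_mul hne] at e
    rw [e] at hlt
    exact lt_irrefl _ hlt
  have huniv : Measure.haarMeasure (haarCompacts B S₀ C hBc) (univ : Set (Πʳ i, [G i, B i])) = 0 := by
    rw [← iUnion_spanningSets μ']; exact measure_iUnion_null hS
  have h2 : Measure.haarMeasure (haarCompacts B S₀ C hBc)
      (haarCompacts B S₀ C hBc : Set (Πʳ i, [G i, B i])) = 0 :=
    measure_mono_null (subset_univ _) huniv
  rw [Measure.haarMeasure_self] at h2
  exact one_ne_zero h2

/-- The rescaling constant `c(μ') = μ'(K₀) / ∏_{i∈S₀} ν_i(C_i)` as an `ℝ≥0`. [folklore] -/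
def haarScalar (μ' : Measure (Πʳ i, [G i, B i])) : ℝ≥0 :=
  (μ' (haarBox B S₀ C) * (∏ i : {i // i ∈ S₀}, ν i (C i : Set (G i)))⁻¹).toNNReal

/-- **Every σ-finite left-invariant measure `μ'` on `Πʳ i, [G i, B i]` IS the restricted product
measure of the local measures rescaled at one place `i₀ ∈ S₀`.** [folklore] -/
theorem eq_rpMeasure_update (hBc : ∀ i, i ∉ S₀ → IsCompact (B i : Set (G i)))
    (hB1 : ∀ i, i ∉ S₀ → ν i (B i : Set (G i)) = 1) {i₀ : ι} (hi₀ : i₀ ∈ S₀)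
    (μ' : Measure (Πʳ i, [G i, B i])) [SigmaFinite μ'] [μ'.IsMulLeftInvariant] :
    μ' = rpMeasure (fun i => (B i : Set (G i)))
      (Function.update ν i₀ (haarScalar B S₀ C ν μ' • ν i₀)) S₀ := by
  have hfin : μ' (haarBox B S₀ C) ≠ ∞ := measure_haarBox_ne_top B S₀ C hBc μ'
  have hBm : ∀ i, MeasurableSet (B i : Set (G i)) := fun i => (hBo.out i).measurableSet
  have hKne : ∀ i, ((B i : Set (G i))).Nonempty := fun i => ⟨1, (B i).one_mem⟩
  haveI := sigmaFinite_update ν i₀ (haarScalar B S₀ C ν μ')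
  have hc : ((haarScalar B S₀ C ν μ' : ℝ≥0) : ℝ≥0∞) =
      μ' (haarBox B S₀ C) * (∏ i : {i // i ∈ S₀}, ν i (C i : Set (G i)))⁻¹ :=
    ENNReal.coe_toNNReal (ENNReal.mul_ne_top hfin (ENNReal.inv_ne_top.2 (prod_haar_ne_zero S₀ C ν)))
  rw [rpMeasure_eq_smul (fun i => (B i : Set (G i))) hKne ν _ hBm hB1 hi₀
      ((haarScalar B S₀ C ν μ' : ℝ≥0) : ℝ≥0∞) _ (fun i hi => Function.update_of_ne hi _ _), hc]
  · exact eq_smul_rpMeasure B S₀ C ν hBc hB1 μ'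
  · rw [Function.update_self]
    ext s
    simp only [Measure.smul_apply, smul_eq_mul, Measure.nnreal_smul_coe_apply]

end anyHaar

end Literature.MeasureTheory.RestrictedProduct

end
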